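import Summits.KontsevichZagierPeriods.KontsevichZagierPeriods.Theorems.LinRedNormalFormArrangementNormalFormStubRebaseSimpleZeroNestedPinchU

/-!
# Stub `stub_rebaseSimpleZeroTwo`, part `rebaseSimpleZero_nestedCommon` (crux `ArrangementNormalForm`,
line `janus-bands`) — brick `NestedPinch`

The PINCH END of a clean nested pair `A(y) < tᵢ < tⱼ < B(y)` (constant letters, simple base
pole) over a one-dimensional base: the bounds meet at the vertex `(y₀, t₀)`. For each side
`ε₁ = ±1` an explicit rational `ε > 0` is produced (`RebaseNest.pinch_side`), depending only on
the data, such that the piece over `cell M₀ ∩ {0 < ε₁ (y − y₀) < ε}` is good for `GG 0 2 2`: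
* `ε` is below the gaps of the rows of `M₀` at `y₀` (`RebaseNest.rows_near`: the piece's cell is
  then empty or exactly the interval), below half the distance to the base pole, and so small
  that `B` stays below the letters above `t₀`;
* by the signs of the opening slopes `ε₁ A' ≤ ε₁ B'`: empty fibres / separable by `κ = t₀`
  (`IsNest.good_sep`) / opening upwards (`RebaseNest.exists_eps_U`: the three sub-cases of brick
  `NestedPinchU`) / opening downwards (reflection `IsNest.reflect`, then upwards).
The blow-up sub-case is the explicit hypothesis `RebaseNest.BlowUp` (worker W4's move).
Registered: `rebaseSimpleZero_nestedPinchSide`.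

References: M. Kontsevich, D. Zagier, *Periods* (2001), §1.2, rules (1a), (2).
-/

noncomputable section

open Set MeasureTheory MvPolynomial
open Literature.NumberTheory.Transcendental Literature.ModelTheory.ExponentialFields

namespace Summit.KontsevichZagierPeriods.ArrangementNormalForm.JanusBands

namespace RebaseNest

open SeparatePos RebasePos RebaseZero

/-! ### Small rationals -/

/-- A positive rational below finitely many positive rationals. [folklore] -/
theorem exists_pos_le_forall {ι : Type*} [Fintype ι] (f : ι → ℚ) (hf : ∀ i, 0 < f i) :
    ∃ ε : ℚ, 0 < ε ∧ ∀ i, ε ≤ f i := by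
  classical
  have key : ∀ S : Finset ι, ∃ ε : ℚ, 0 < ε ∧ ∀ i ∈ S, ε ≤ f i := by
    intro S
    induction S using Finset.induction_on with
    | empty => exact ⟨1, one_pos, fun i hi => absurd hi (Finset.notMem_empty i)⟩
    | insert b S _ ih =>
      obtain ⟨ε, hε, h⟩ := ih
      refine ⟨min ε (f b), lt_min hε (hf b), fun i hi => ?_⟩
      rcases Finset.mem_insert.1 hi with rfl | hi
      · exact min_le_right _ _
      · exact (min_le_left _ _).trans (h i hi)
  obtain ⟨ε, hε, h⟩ := key Finset.univ
  exact ⟨ε, hε, fun i => h i (Finset.mem_univ i)⟩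

/-- An affine function keeps the sign of its value `v ≠ 0` at `y₀` on `{0 < Y < εr}` as soon as
`εr ≤ |v|/(|μ| + 1)` (`μ` its slope in `Y`). [folklore] -/
theorem affine_keeps_sign {v μ Y εr : ℝ} (hY0 : 0 < Y) (hY : Y < εr) (hεr : εr ≤ |v| / (|μ| + 1)) :
    (0 < v → 0 < v + μ * Y) ∧ (v < 0 → v + μ * Y < 0) := by
  have h1 : |μ * Y| ≤ |μ| * εr := by
    rw [abs_mul, abs_of_pos hY0]
    exact mul_le_mul_of_nonneg_left hY.le (abs_nonneg _)
  have h2 : |μ| * εr ≤ |μ| * (|v| / (|μ| + 1)) := mul_le_mul_of_nonneg_left hεr (abs_nonneg _)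
  have h3 : v ≠ 0 → |μ| * (|v| / (|μ| + 1)) < |v| := fun hv => by
    rw [mul_div_assoc', div_lt_iff₀ (by positivity)]
    nlinarith [abs_pos.2 hv, abs_nonneg μ]
  constructor
  · intro hv
    have := h3 hv.ne'
    have habs : |v| = v := abs_of_pos hv
    linarith [neg_abs_le (μ * Y)]
  · intro hv
    have := h3 hv.ne
    have habs : |v| = -v := abs_of_neg hv
    linarith [le_abs_self (μ * Y)]

/-- **The rows near a point.** For every row matrix `M₀`, point `y₀` and side `ε₁ = ±1` there is
a rational `εr > 0` such that the interval `{0 < ε₁ (y − y₀) < εr}` lies inside the base cell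
or is disjoint from it. [folklore] -/
theorem rows_near {m₀ : ℕ} (M₀ : Fin m₀ → Cf) (y₀ ε₁ : ℚ) (hε₁ : ε₁ = 1 ∨ ε₁ = -1) :
    ∃ εr : ℚ, 0 < εr ∧
      ((∀ y : ℝ, 0 < (ε₁ : ℝ) * (y - y₀) → (ε₁ : ℝ) * (y - y₀) < εr → y ∈ cell M₀) ∨
       (∀ y : ℝ, 0 < (ε₁ : ℝ) * (y - y₀) → (ε₁ : ℝ) * (y - y₀) < εr → y ∉ cell M₀)) := by
  classical
  -- the value and the slope of a row at `y₀`
  set v : Fin m₀ → ℚ := fun r => (M₀ r).1 (Fin.last 0) * y₀ + (M₀ r).2 with hv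
  set μ : Fin m₀ → ℚ := fun r => (M₀ r).1 (Fin.last 0) with hμ
  obtain ⟨εr, hεr, hle⟩ := exists_pos_le_forall
    (fun r => if v r = 0 then 1 else |v r| / (|μ r| + 1)) fun r => by
      split_ifs with h
      · exact one_pos
      · exact div_pos (abs_pos.2 h) (by positivity)
  have hε2 : (ε₁ : ℝ) * ε₁ = 1 := by rcases hε₁ with rfl | rfl <;> norm_num
  have hεa : |(ε₁ : ℝ)| = 1 := by rcases hε₁ with rfl | rfl <;> norm_num
  -- a row along the interval
  have hrow : ∀ (r : Fin m₀) (y : ℝ), ev (M₀ r) y = v r + (ε₁ * μ r) * (ε₁ * (y - y₀)) := fun r y => by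
    simp only [hv, hμ, ev, Rat.cast_add, Rat.cast_mul]
    linear_combination (-((M₀ r).1 (Fin.last 0) : ℝ) * (y - y₀)) * hε2
  have hgap : ∀ r, v r ≠ 0 → (εr : ℝ) ≤ |(v r : ℝ)| / (|(ε₁ : ℝ) * μ r| + 1) := fun r h => by
    have := hle r
    rw [if_neg h] at this
    rw [abs_mul, hεa, one_mul]
    exact_mod_cast this
  refine ⟨εr, hεr, ?_⟩
  by_cases hall : ∀ r, 0 < v r ∨ (v r = 0 ∧ 0 < ε₁ * μ r)
  · refine Or.inl fun y h1 h2 r => ?_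
    rw [hrow]
    rcases hall r with h | ⟨h0, hs⟩
    · exact (affine_keeps_sign h1 h2 (hgap r h.ne')).1 (by exact_mod_cast h)
    · rw [h0, Rat.cast_zero, zero_add]
      exact mul_pos (by exact_mod_cast hs) h1
  · push Not at hall
    obtain ⟨r, hr1, hr2⟩ := hall
    refine Or.inr fun y h1 h2 hy => ?_
    have hpos := hy r
    rw [hrow] at hpos
    rcases lt_or_eq_of_le hr1 with h | h0
    · have := (affine_keeps_sign h1 h2 (hgap r h.ne)).2 (by exact_mod_cast h)
      linarith
    · have hs : (ε₁ : ℝ) * μ r ≤ 0 := by exact_mod_cast hr2 h0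
      rw [h0, Rat.cast_zero, zero_add] at hpos
      nlinarith

/-! ### The side `ε₁` of a pinch end -/

variable {m₀ : ℕ} {i j : Fin 2} {A Bd : Cf} {T : BData} {a : Fin 2 → Option Cf} {y₀ t₀ ε₁ : ℚ}

/-- The cell of a pinch piece: the rows `M₀`, the side row `r₁` and the cap `ε`. [folklore] -/
theorem mem_cell_piece (M₀ : Fin m₀ → Cf) {r₁ : Cf} (hr₁ : ∀ y : ℝ, ev r₁ y = ε₁ * (y - y₀)) (ε : ℚ)
    (y : ℝ) : y ∈ cell (Fin.snoc (Fin.snoc M₀ r₁ : Fin (m₀ + 1) → Cf) (RebaseZero.mk (-ε₁) (ε₁ * y₀ + ε)) :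
      Fin (m₀ + 2) → Cf) ↔ y ∈ cell M₀ ∧ 0 < (ε₁ : ℝ) * (y - y₀) ∧ (ε₁ : ℝ) * (y - y₀) < ε := by
  rw [mem_cell_snoc, mem_cell_snoc, hr₁, ev_mk, and_assoc]
  push_cast
  refine and_congr_right fun _ => and_congr_right fun _ => ?_
  constructor <;> intro h <;> linarith

/-- The difference of two bounds through the vertex. [folklore] -/
theorem ev_sub_vertex (hA0 : A.1 (Fin.last 0) * y₀ + A.2 = t₀) (hB0 : Bd.1 (Fin.last 0) * y₀ + Bd.2 = t₀)
    (y : ℝ) : ev Bd y - ev A y = ((Bd.1 (Fin.last 0) : ℝ) - A.1 (Fin.last 0)) * (y - y₀) := by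
  have hA : (A.1 (Fin.last 0) : ℝ) * y₀ + A.2 = t₀ := by
    have h := congrArg (fun q : ℚ => (q : ℝ)) hA0
    simp only [Rat.cast_add, Rat.cast_mul] at h
    exact h
  have hB : (Bd.1 (Fin.last 0) : ℝ) * y₀ + Bd.2 = t₀ := by
    have h := congrArg (fun q : ℚ => (q : ℝ)) hB0
    simp only [Rat.cast_add, Rat.cast_mul] at h
    exact h
  simp only [ev]
  linear_combination hB - hA

/-- **The upward-opening side of a pinch end** (`0 < ε₁ A' ≤ ε₁ B'`): an explicit `ε > 0` such
that the piece over `cell M₀ ∩ {0 < ε₁ (y − y₀) < ε}` is good (the three sub-cases of brick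
`NestedPinchU`, or an empty cell). -/
theorem exists_eps_U (hij : i ≠ j) (T : BData) (a : Fin 2 → Option Cf) (hε₁ : ε₁ = 1 ∨ ε₁ = -1)
    (hA0 : A.1 (Fin.last 0) * y₀ + A.2 = t₀) (hB0 : Bd.1 (Fin.last 0) * y₀ + Bd.2 = t₀)
    (hα : 0 < ε₁ * A.1 (Fin.last 0)) (hαβ : ε₁ * A.1 (Fin.last 0) ≤ ε₁ * Bd.1 (Fin.last 0)) (hB : BlowUp)
    (M₀ : Fin m₀ → Cf) (r₁ : Cf) (hr₁ : ∀ y : ℝ, ev r₁ y = ε₁ * (y - y₀)) :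
    ∃ ε : ℚ, 0 < ε ∧ ∀ (s : KZ.IntegralRep (0 + 1 + 2)) (p : MvPolynomial (Fin 0) ℚ),
      IsNest s (Fin.snoc (Fin.snoc M₀ r₁ : Fin (m₀ + 1) → Cf) (RebaseZero.mk (-ε₁) (ε₁ * y₀ + ε)) :
        Fin (m₀ + 2) → Cf) i j A Bd T p a → Good 2 (KZ.of s) := by
  classical
  set β' : ℚ := ε₁ * Bd.1 (Fin.last 0) with hβ'
  have hβ : 0 < β' := hα.trans_le hαβ
  -- room above `t₀` below the letters above `t₀`
  obtain ⟨θ, hθ, hθle⟩ := exists_pos_le_forall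
    (fun l => (a l).elim 1 fun c => if t₀ < c.2 then (c.2 - t₀) / 2 else 1) fun l => by
      rcases a l with _ | c
      · exact one_pos
      · simp only [Option.elim_some]
        split_ifs with h
        · linarith
        · exact one_pos
  have hθ2 : ∀ l c, a l = some c → t₀ < c.2 → 2 * θ ≤ c.2 - t₀ := fun l c hc hlt => by
    have := hθle l
    simp only [hc, Option.elim_some, if_pos hlt] at this
    linarith
  -- distance of the letters below `t₀`
  obtain ⟨η₀, hη₀, hη₀le⟩ := exists_pos_le_forall
    (fun l => (a l).elim 1 fun c => if c.2 < t₀ then t₀ - c.2 else 1) fun l => by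
      rcases a l with _ | c
      · exact one_pos
      · simp only [Option.elim_some]
        split_ifs with h
        · linarith
        · exact one_pos
  have hηb : ∀ l c, a l = some c → c.2 < t₀ → η₀ ≤ t₀ - c.2 := fun l c hc hlt => by
    have := hη₀le l
    simp only [hc, Option.elim_some, if_pos hlt] at this
    exact this
  set η : ℚ := min θ η₀ with hηdef
  have hη : 0 < η := lt_min hθ hη₀
  set Tc : ℚ := t₀ + θ with hTc
  have hfar : ∀ l c, a l = some c → c.2 ≠ t₀ → ∀ t : ℝ, (t₀ : ℝ) < t → t < Tc → (η : ℝ) ≤ |t - c.2| := by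
    intro l c hc hne t ht1 ht2
    rw [hTc, Rat.cast_add] at ht2
    rcases lt_or_gt_of_ne hne with hlt | hgt
    · have h1 : ((min θ η₀ : ℚ) : ℝ) ≤ η₀ := by exact_mod_cast min_le_right θ η₀
      have h2 : (η₀ : ℝ) ≤ t₀ - c.2 := by exact_mod_cast hηb l c hc hlt
      have h3 : (c.2 : ℝ) < t₀ := by exact_mod_cast hlt
      rw [abs_of_pos (by linarith)]
      linarith
    · have h1 : ((min θ η₀ : ℚ) : ℝ) ≤ θ := by exact_mod_cast min_le_left θ η₀
      have h2 : 2 * (θ : ℝ) ≤ c.2 - t₀ := by exact_mod_cast hθ2 l c hc hgt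
      have h3 : (t₀ : ℝ) < c.2 := by exact_mod_cast hgt
      rw [abs_of_neg (by linarith)]
      linarith
  -- the base pole
  set ρ : ℚ := T.ℓ₂.2 with hρ
  set εp : ℚ := if ρ = y₀ then 1 else |ρ - y₀| / 2 with hεp
  have hεp0 : 0 < εp := by
    rw [hεp]; split_ifs with h
    · exact one_pos
    · exact div_pos (abs_pos.2 (sub_ne_zero.2 h)) two_pos
  -- the rows
  obtain ⟨εr, hεr, hrows⟩ := rows_near M₀ y₀ ε₁ hε₁
  -- the cap
  set ε : ℚ := min (min εr εp) (θ / β') with hεdef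
  have hε : 0 < ε := lt_min (lt_min hεr hεp0) (div_pos hθ hβ)
  have hεr' : ε ≤ εr := (min_le_left _ _).trans (min_le_left _ _)
  have hεp' : ε ≤ εp := (min_le_left _ _).trans (min_le_right _ _)
  have hεθ : β' * ε ≤ θ := by
    have : ε ≤ θ / β' := min_le_right _ _
    rwa [le_div_iff₀ hβ, mul_comm] at this
  refine ⟨ε, hε, fun s p hN => ?_⟩
  have hcell : ∀ y ∈ cell (Fin.snoc (Fin.snoc M₀ r₁ : Fin (m₀ + 1) → Cf) (RebaseZero.mk (-ε₁) (ε₁ * y₀ + ε)) :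
      Fin (m₀ + 2) → Cf), 0 < (ε₁ : ℝ) * (y - y₀) ∧ (ε₁ : ℝ) * (y - y₀) < ε := fun y hy => by
    rw [mem_cell_piece M₀ hr₁] at hy
    exact hy.2
  rcases hrows with hin | hout
  swap
  · -- the cell of the piece is empty
    refine hN.good_cell_empty fun y hy => ?_
    rw [mem_cell_piece M₀ hr₁] at hy
    obtain ⟨hy, h1, h2⟩ := hy
    have : (ε : ℝ) ≤ εr := by exact_mod_cast hεr'
    exact hout y h1 (by linarith) hy
  -- the cell of the piece is exactly the interval
  have hcellI : ∀ y : ℝ, y ∈ cell (Fin.snoc (Fin.snoc M₀ r₁ : Fin (m₀ + 1) → Cf)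
      (RebaseZero.mk (-ε₁) (ε₁ * y₀ + ε)) : Fin (m₀ + 2) → Cf) ↔
      (0 < (ε₁ : ℝ) * (y - y₀) ∧ (ε₁ : ℝ) * (y - y₀) < ε) := fun y => by
    rw [mem_cell_piece M₀ hr₁]
    refine ⟨fun h => h.2, fun h => ⟨hin y h.1 ?_, h⟩⟩
    have : (ε : ℝ) ≤ εr := by exact_mod_cast hεr'
    linarith [h.2]
  -- the bounds on the piece
  have key : ∀ y : ℝ, 0 < (ε₁ : ℝ) * (y - y₀) → (ε₁ : ℝ) * (y - y₀) < ε →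
      ev Bd y < Tc ∧ |y - y₀| < ε := fun y h1 h2 => by
    obtain ⟨eB, habs⟩ := ev_vertex hε₁ hB0 h1
    have hβε : (ε₁ : ℝ) * Bd.1 (Fin.last 0) * ε ≤ θ := by
      have := hεθ; rw [hβ'] at this; exact_mod_cast this
    have hβ0 : (0 : ℝ) < ε₁ * Bd.1 (Fin.last 0) := by have := hβ; rw [hβ'] at this; exact_mod_cast this
    rw [habs] at eB ⊢
    rw [eB, hTc, Rat.cast_add]
    exact ⟨by nlinarith, h2⟩
  -- distance to the base pole
  have hpole : ρ ≠ y₀ → ∀ y : ℝ, 0 < (ε₁ : ℝ) * (y - y₀) → (ε₁ : ℝ) * (y - y₀) < ε →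
      |y - y₀| < |(ρ : ℝ) - y₀| / 2 ∧ (|(ρ : ℝ) - y₀| / 2 : ℝ) ≤ |y - ρ| := fun hne y h1 h2 => by
    have hlt := (key y h1 h2).2
    have hεd : (ε : ℝ) ≤ |(ρ : ℝ) - y₀| / 2 := by
      have := hεp'; rw [hεp, if_neg hne] at this; exact_mod_cast this
    have htri : |(ρ : ℝ) - y₀| ≤ |y - ρ| + |y - y₀| := by
      have := abs_sub_le (ρ : ℝ) y y₀
      rwa [abs_sub_comm (ρ : ℝ) y] at this
    exact ⟨by linarith, by linarith⟩
  by_cases hat : ∀ l c, a l = some c → c.2 ≠ t₀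
  · -- U1: no letter at `t₀`
    refine hN.good_pinch_free y₀ t₀ ε₁ ε η hε₁ hA0 hB0 hα hαβ hcell (fun y hy => ?_) hη
      fun l c hc y hy t ht1 ht2 => ?_
    · obtain ⟨h1, h2⟩ := hcell y hy
      change |y - (y₀ : ℝ)| ≤ |y - ρ|
      by_cases hne : ρ = y₀
      · rw [hne]
      · obtain ⟨hl, hd⟩ := hpole hne y h1 h2
        linarith
    · obtain ⟨h1, h2⟩ := hcell y hy
      exact hfar l c hc (hat l c hc) t ht1 (ht2.trans (key y h1 h2).1)
  push Not at hat
  obtain ⟨l₁, c₁, hc₁, hct⟩ := hat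
  have hat' : ∃ l₀ : Fin 2, ∀ l c, l ≠ l₀ → a l = some c → c.2 = t₀ := by
    rcases fin_two_eq_or hij l₁ with rfl | rfl
    · refine ⟨j, fun l c hl hc => ?_⟩
      rcases fin_two_eq_or hij l with rfl | rfl
      · rw [hc₁] at hc; cases hc; exact hct
      · exact absurd rfl hl
    · refine ⟨i, fun l c hl hc => ?_⟩
      rcases fin_two_eq_or hij l with rfl | rfl
      · exact absurd rfl hl
      · rw [hc₁] at hc; cases hc; exact hct
  by_cases hρy : ρ = y₀
  · -- U3: blow-up (or empty fibres)
    rcases lt_or_eq_of_le hαβ with hlt | heq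
    · exact hN.good_pinch_blow hB y₀ t₀ ε₁ ε hε₁ hε hA0 hB0 hα hlt (by rw [← hρy]) hat' hcellI
    · refine hN.good_empty fun y hy => ?_
      obtain ⟨h1, -⟩ := hcell y hy
      obtain ⟨eA, -⟩ := ev_vertex hε₁ hA0 h1
      obtain ⟨eB, -⟩ := ev_vertex hε₁ hB0 h1
      have : (ε₁ : ℝ) * A.1 (Fin.last 0) = ε₁ * Bd.1 (Fin.last 0) := by exact_mod_cast heq
      rw [eA, eB, this]
  · -- U2: super-section Janus
    refine hN.good_pinch_super y₀ t₀ ε₁ ε Tc η (|ρ - y₀| / 2) hε₁ hA0 hB0 hα hαβ hcell ?_ hη hfar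
      (div_pos (abs_pos.2 (sub_ne_zero.2 hρy)) two_pos) fun y hy => ?_
    · rw [hTc, hβ'] at *
      linarith
    · obtain ⟨h1, h2⟩ := hcell y hy
      have := (hpole hρy y h1 h2).2
      change (((|ρ - y₀| / 2 : ℚ)) : ℝ) ≤ |y - ρ|
      push_cast
      exact this

/-- **One side of a pinch end.** For a clean nest whose bounds meet at the vertex `(y₀, t₀)`
there is, for each side `ε₁ = ±1`, an explicit `ε > 0` such that the piece over
`cell M₀ ∩ {0 < ε₁ (y − y₀) < ε}` is good for `GG 0 2 2`: empty fibres, or separable by `t₀`,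
or opening upwards (`exists_eps_U`), or opening downwards (reflect both fibres, then upwards). -/
theorem pinch_side (hij : i ≠ j) (T : BData) (a : Fin 2 → Option Cf) (hε₁ : ε₁ = 1 ∨ ε₁ = -1)
    (hA0 : A.1 (Fin.last 0) * y₀ + A.2 = t₀) (hB0 : Bd.1 (Fin.last 0) * y₀ + Bd.2 = t₀) (hB : BlowUp)
    (M₀ : Fin m₀ → Cf) (r₁ : Cf) (hr₁ : ∀ y : ℝ, ev r₁ y = ε₁ * (y - y₀)) :
    ∃ ε : ℚ, 0 < ε ∧ ∀ (s : KZ.IntegralRep (0 + 1 + 2)) (p : MvPolynomial (Fin 0) ℚ),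
      IsNest s (Fin.snoc (Fin.snoc M₀ r₁ : Fin (m₀ + 1) → Cf) (RebaseZero.mk (-ε₁) (ε₁ * y₀ + ε)) :
        Fin (m₀ + 2) → Cf) i j A Bd T p a → Good 2 (KZ.of s) := by
  set α' : ℚ := ε₁ * A.1 (Fin.last 0) with hα'
  set β' : ℚ := ε₁ * Bd.1 (Fin.last 0) with hβ'
  have hcell : ∀ (ε : ℚ), ∀ y ∈ cell (Fin.snoc (Fin.snoc M₀ r₁ : Fin (m₀ + 1) → Cf)
      (RebaseZero.mk (-ε₁) (ε₁ * y₀ + ε)) : Fin (m₀ + 2) → Cf), 0 < (ε₁ : ℝ) * (y - y₀) := fun ε y hy => by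
    rw [mem_cell_piece M₀ hr₁] at hy
    exact hy.2.1
  by_cases hβα : β' ≤ α'
  · -- empty fibres
    refine ⟨1, one_pos, fun s p hN => hN.good_empty fun y hy => ?_⟩
    have h1 := hcell 1 y hy
    obtain ⟨eA, -⟩ := ev_vertex hε₁ hA0 h1
    obtain ⟨eB, -⟩ := ev_vertex hε₁ hB0 h1
    have : (ε₁ : ℝ) * Bd.1 (Fin.last 0) ≤ ε₁ * A.1 (Fin.last 0) := by exact_mod_cast hβα
    rw [eA, eB]
    nlinarith [abs_nonneg (y - y₀)]
  push Not at hβα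
  by_cases hαp : 0 < α'
  · -- opening upwards
    exact exists_eps_U hij T a hε₁ hA0 hB0 hαp hβα.le hB M₀ r₁ hr₁
  by_cases hβp : 0 ≤ β'
  · -- separable by `t₀`
    refine ⟨1, one_pos, fun s p hN => hN.good_sep t₀ fun y hy => ?_⟩
    have h1 := hcell 1 y hy
    obtain ⟨eA, -⟩ := ev_vertex hε₁ hA0 h1
    obtain ⟨eB, -⟩ := ev_vertex hε₁ hB0 h1
    have hαn : (ε₁ : ℝ) * A.1 (Fin.last 0) ≤ 0 := by exact_mod_cast not_lt.1 hαp
    have hβn : (0 : ℝ) ≤ ε₁ * Bd.1 (Fin.last 0) := by exact_mod_cast hβp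
    rw [eA, eB]
    constructor <;> nlinarith [abs_nonneg (y - y₀)]
  -- opening downwards: reflect both fibres
  push Not at hβp
  have hA0' : (-Bd).1 (Fin.last 0) * y₀ + (-Bd).2 = -t₀ := by rw [neg_fst, Prod.snd_neg, ← hB0]; ring
  have hB0' : (-A).1 (Fin.last 0) * y₀ + (-A).2 = -t₀ := by rw [neg_fst, Prod.snd_neg, ← hA0]; ring
  have hα2 : 0 < ε₁ * (-Bd).1 (Fin.last 0) := by rw [neg_fst, mul_neg]; linarith
  have hαβ2 : ε₁ * (-Bd).1 (Fin.last 0) ≤ ε₁ * (-A).1 (Fin.last 0) := by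
    rw [neg_fst, neg_fst, mul_neg, mul_neg]; linarith
  obtain ⟨ε, hε, hgood⟩ := exists_eps_U hij.symm T (fun l => (a l).map Neg.neg) hε₁ hA0' hB0' hα2 hαβ2 hB
    M₀ r₁ hr₁
  refine ⟨ε, hε, fun s p hN => ?_⟩
  obtain ⟨s', hN', hrel⟩ := hN.reflect
  exact good_of_sub_mem hrel (hgood s' _ hN')

end RebaseNest

/-- Registered support goal of this file (part of `rebaseSimpleZero_nestedCommon`): one side of a
pinch end of a clean nested pair is good on an explicit short piece (`RebaseNest.pinch_side`). -/
theorem rebaseSimpleZero_nestedPinchSide (m₀ : ℕ) (i j : Fin 2) (hij : i ≠ j) (A Bd : (Fin (0 + 1) → ℚ) × ℚ) (T : RebaseZero.BData) (a : Fin 2 → Option ((Fin (0 + 1) → ℚ) × ℚ)) (y₀ t₀ ε₁ : ℚ) (hε₁ : ε₁ = 1 ∨ ε₁ = -1) (hA0 : A.1 (Fin.last 0) * y₀ + A.2 = t₀) (hB0 : Bd.1 (Fin.last 0) * y₀ + Bd.2 = t₀) (hB : RebaseNest.BlowUp) (M₀ : Fin m₀ → (Fin (0 + 1) → ℚ) ×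 ℚ) (r₁ : (Fin (0 + 1) → ℚ) × ℚ) (hr₁ : ∀ y : ℝ, RebaseZero.ev r₁ y = ε₁ * (y - y₀)) : ∃ ε : ℚ, 0 < ε ∧ ∀ (s : KZ.IntegralRep (0 + 1 + 2)) (p : MvPolynomial (Fin 0) ℚ), RebaseNest.IsNest s (Fin.snoc (Fin.snoc M₀ r₁ : Fin (m₀ + 1) → (Fin (0 + 1) → ℚ) × ℚ) (RebaseZero.mk (-ε₁) (ε₁ * y₀ + ε)) : Fin (m₀ + 2) → (Fin (0 + 1) → ℚ) × ℚ) i j A Bd T p a → RebaseZero.Good 2 (KZ.of s) :=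
  RebaseNest.pinch_side hij T a hε₁ hA0 hB0 hB M₀ r₁ hr₁

end Summit.KontsevichZagierPeriods.ArrangementNormalForm.JanusBands
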